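import Literature.AlgebraicGeometry.AbelianSchemes.AbelianSchemeDualPair
import Literature.AlgebraicGeometry.Modules.DetClassOfIso
import Literature.AlgebraicGeometry.AbelianVarieties.HomogeneousLineBundleDivisor
import Literature.AlgebraicGeometry.Motives.AbelianVarietyConjugateBaseChangeAlong
import Literature.AlgebraicGeometry.Motives.AbelianVarietyWeilPairingPullback
import HarnessLib

/-!
# Transitivity of base change for abelian schemes AS GROUP SCHEMES, the fibres of a base change,
# and transport of homogeneity along isomorphisms (Görtz–Wedhorn I (4.7); [MFK94] Ch. 7 §2 Def. 7.2/7.3)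

Layer `Literature/AlgebraicGeometry/AbelianSchemes`, namespaces `Literature.AlgebraicGeometry.AbelianSchemes.AbelianSchemeOver`
and `Literature.AlgebraicGeometry.AbelianVarieties`.  Cell `hodgecm-mathlib`, rung-0 carrier junction D-BC∃ (§0 of the
D2-third; consumed by `AbelianSchemes/AbelianSchemeDualPairBaseChange`, by the assembler's
`PolarizedAbelianSchemeWithLevel.baseChange`, and by the D3-third).  Definitions with bodies (isomorphisms) and theorems;
no named fact, no instance, no notation.

For an abelian scheme `A/S` (★ `AbelianSchemeOver`, [MumfordFogartyKirwan1994, Def. 6.1]), `g : S' ⟶ S` and `f' : T ⟶ S'`: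

* **`baseChangeCompGrpIso (g) (f') : (A.baseChange (f' ≫ g)).toGrp ≅ ((A.baseChange g).baseChange f').toGrp`** in
  `Grp (Over T)` — `A ×_S T ≅ (A ×_S S') ×_{S'} T` COMPATIBLY WITH THE GROUP LAWS: Mathlib's `Over.pullbackComp f' g` is
  monoidal for the cartesian structures, hence lifts to group objects (`Functor.mapGrpNatIso`, `Functor.mapGrpCompIso`;
  the affine-base pattern of ★ `AbelianScheme.fibreToGrpBaseChangeIso`), with its underlying morphisms
  (`_hom_hom_hom`/`_inv_hom_hom` = the components of `Over.pullbackComp`), their projection formulas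
  (`_inv_left_fst`, `_inv_left_snd`, `_hom_left_snd`, `_hom_left_fst_fst`, from ★
  `Motives.pullbackComp_{inv,hom}_app_left_comp_fst{,_fst}`), `hom ≫ inv = 𝟙` on schemes, and the identity sections
  (`unitSection_comp_baseChangeCompGrpIso_hom_left`, `IsMonHom.one_hom`);
* `unitSection_baseChange_comp_fst : ε_{A_{S'}} ≫ pr_A = g ≫ ε_A` (the unit clause of ★ `IsBaseChangeVia` for the
  chosen base change);
* **`fibreBaseChangeIso (g) (t) : ((A.baseChange g).fibre t).toAbelianVariety ≅ (A.fibre (t ≫ g)).toAbelianVariety`**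
  (`InducedCategory.isoMk` of the above at `T = Spec Ω`) with `_hom_toSchemeHom_fst/_snd`;
* `bcHomLeft`/`bcInvLeft` (the underlying `T`-morphisms), `pullbackHomPullbackInvIso`/`pullbackInvPullbackHomIso`
  (`e^*(e⁻¹)^*M ≅ M`), `fibreAlongBaseChangeIso (g) (f') (u)` (the fibres of `A_{f' ≫ g}` and `(A_{S'})_{f'}` at
  `u : Spec Ω → T`, `Functor.mapGrp.mapIso`) with `_hom_toSchemeHom_fst`;
* `AbelianVarieties.isHomogeneous_pullback_of_iso` / **`isHomogeneous_pullback_iff_of_iso (φ : A₁ ≅ A₂) (E) :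
  IsHomogeneous A₁ (φ^*E) ↔ IsHomogeneous A₂ E`** — Mukai's homogeneity ([Mukai1978, Def. 4.4]; [MumfordAV1970] §8
  `Pic⁰`) moves along isomorphisms of abelian varieties (★ `translation_left_comp_toSchemeHom`: `t_P ≫ φ = φ ≫ t_{φ P}`).

## References
* [GortzWedhorn2020] U. Görtz, T. Wedhorn, *Algebraic Geometry I*, 2nd ed. (2020), Section (4.7) (p. 135), Prop. 4.16,
  Remark 16.54 (p. 678).
* [MumfordFogartyKirwan1994] D. Mumford, J. Fogarty, F. Kirwan, *Geometric Invariant Theory*, 3rd ed. (1994), Ch. 6 §1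
  Def. 6.1 (p. 115), Ch. 7 §2 Def. 7.2–7.3 (pp. 129–130: the moduli functor «in the obvious way», by pull-back).
* [MumfordAV1970] D. Mumford, *Abelian Varieties* (1970), §4 (Cor. 1 of the rigidity lemma), §8 ((iv) ⇔ (i)).
* [Mukai1978] S. Mukai, *Semi-homogeneous vector bundles on an abelian variety* (1978), Def. 4.4 (p. 253).
-/

universe u

open CategoryTheory CategoryTheory.Limits AlgebraicGeometry MonoidalCategory

noncomputable section

namespace Literature.AlgebraicGeometry.AbelianVarieties

open Literature.AlgebraicGeometry.Motives Literature.AlgebraicGeometry.Modules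


variable {K : Type u} [Field K] {A₁ A₂ : AbelianVariety K}

/-- Pulling a module back along `f` and then along `g` is pulling back along `g ≫ f` (Mathlib
`Scheme.Modules.pullbackComp`, applied to an object; non-Prop-free restatement as an isomorphism of modules).
[folklore] -/
private def pullbackPullbackIso {X Y Z : Scheme.{u}} (g : X ⟶ Y) (f : Y ⟶ Z) (E : Z.Modules) :
    (Scheme.Modules.pullback g).obj ((Scheme.Modules.pullback f).obj E) ≅ (Scheme.Modules.pullback (g ≫ f)).obj E :=
  (Scheme.Modules.pullbackComp g f).app E

/-- **Homogeneity is transported along an isomorphism of abelian varieties**: for `φ : A₁ ≅ A₂` and a module `E` on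
`A₂`, `φ^*E` is homogeneous on `A₁` iff `E` is homogeneous on `A₂` (a homomorphism intertwines `t_P` with
`t_{φ P}`, ★ `translation_left_comp_toSchemeHom`; Mukai's notion is isomorphism-invariant). [cite: Mukai1978, Def. 4.4 (p. 253)]
[cite: MumfordAV1970, §4 (Cor. 1 of the rigidity lemma)] -/
theorem isHomogeneous_pullback_of_iso (φ : A₁ ≅ A₂) (E : A₂.X.left.Modules) (h : IsHomogeneous A₂ E) :
    IsHomogeneous A₁ ((Scheme.Modules.pullback (AbelianVariety.Hom.toSchemeHom φ.hom)).obj E) := by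
  intro P
  obtain ⟨e⟩ := h (AlgPoints.map φ.hom.hom.hom.hom P)
  have hc : (A₁.translation P).left ≫ AbelianVariety.Hom.toSchemeHom φ.hom =
      AbelianVariety.Hom.toSchemeHom φ.hom ≫ (A₂.translation (AlgPoints.map φ.hom.hom.hom.hom P)).left :=
    AbelianVariety.translation_left_comp_toSchemeHom φ.hom P
  exact ⟨pullbackPullbackIso _ _ E ≪≫ (Scheme.Modules.pullbackCongr hc).app E ≪≫
    (pullbackPullbackIso _ _ E).symm ≪≫ (Scheme.Modules.pullback _).mapIso e⟩

/-- `(φ⁻¹)^* φ^* E ≅ E` for an isomorphism `φ` of abelian varieties. [folklore] -/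
private def pullbackInvPullbackHomIso (φ : A₁ ≅ A₂) (E : A₂.X.left.Modules) :
    (Scheme.Modules.pullback (AbelianVariety.Hom.toSchemeHom φ.inv)).obj
        ((Scheme.Modules.pullback (AbelianVariety.Hom.toSchemeHom φ.hom)).obj E) ≅ E :=
  pullbackPullbackIso _ _ E ≪≫
    (Scheme.Modules.pullbackCongr (show AbelianVariety.Hom.toSchemeHom φ.inv ≫
        AbelianVariety.Hom.toSchemeHom φ.hom = 𝟙 _ from
      congrArg AbelianVariety.Hom.toSchemeHom φ.inv_hom_id)).app E ≪≫
    (Scheme.Modules.pullbackId _).app E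

/-- **Homogeneity along an isomorphism of abelian varieties, `iff` form**: `φ^*E` is homogeneous on `A₁` iff `E` is
homogeneous on `A₂`. [cite: Mukai1978, Def. 4.4 (p. 253)] [cite: MumfordAV1970, §4 (Cor. 1 of the rigidity lemma)] -/
theorem isHomogeneous_pullback_iff_of_iso (φ : A₁ ≅ A₂) (E : A₂.X.left.Modules) :
    IsHomogeneous A₁ ((Scheme.Modules.pullback (AbelianVariety.Hom.toSchemeHom φ.hom)).obj E) ↔
      IsHomogeneous A₂ E := by
  refine ⟨fun h => ?_, isHomogeneous_pullback_of_iso φ E⟩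
  have h' := isHomogeneous_pullback_of_iso φ.symm _ h
  exact (isHomogeneous_iff_of_iso A₂ (pullbackInvPullbackHomIso φ E)).1 h'

end Literature.AlgebraicGeometry.AbelianVarieties

namespace Literature.AlgebraicGeometry.AbelianSchemes

open Literature.AlgebraicGeometry.Motives Literature.AlgebraicGeometry.AbelianVarieties
  Literature.AlgebraicGeometry.Modules
open scoped MonObj CategoryTheory.Obj

namespace AbelianSchemeOver

variable {S S' T : Scheme.{u}} (A : AbelianSchemeOver S) (g : S' ⟶ S)

/-! ### §0 Transitivity of base change as GROUP schemes, and the fibre form -/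

/-- **Transitivity of base change for abelian schemes, as group schemes over `T`**: `A ×_S T ≅ (A ×_S S') ×_{S'} T`
for `T → S' → S`, compatibly with the group laws — Mathlib's `Over.pullbackComp f' g` is monoidal for the cartesian
structures, hence lifts to group objects (`Functor.mapGrpNatIso`, `Functor.mapGrpCompIso`; the pattern of ★
`AbelianScheme.fibreToGrpBaseChangeIso`). [cite: GortzWedhorn2020, Section (4.7) (p. 135) and Remark 16.54 (p. 678)] -/
def baseChangeCompGrpIso (f' : T ⟶ S') :
    (A.baseChange (f' ≫ g)).toGrp ≅ ((A.baseChange g).baseChange f').toGrp :=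
  (Functor.mapGrpNatIso (Over.pullbackComp f' g) ≪≫ Functor.mapGrpCompIso).app A.toGrp

/-- The underlying `T`-morphism of `baseChangeCompGrpIso` is the component of `Over.pullbackComp`.
[cite: GortzWedhorn2020, Section (4.7) (p. 135)] -/
theorem baseChangeCompGrpIso_hom_hom_hom (f' : T ⟶ S') :
    (A.baseChangeCompGrpIso g f').hom.hom.hom = (Over.pullbackComp f' g).hom.app A.X := by
  simp [baseChangeCompGrpIso, Functor.mapGrpNatIso, Functor.mapGrpCompIso]
  exact Category.comp_id _

/-- The underlying `T`-morphism of the inverse of `baseChangeCompGrpIso`. [cite: GortzWedhorn2020, Section (4.7) (p. 135)] -/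
theorem baseChangeCompGrpIso_inv_hom_hom (f' : T ⟶ S') :
    (A.baseChangeCompGrpIso g f').inv.hom.hom = (Over.pullbackComp f' g).inv.app A.X := by
  simp [baseChangeCompGrpIso, Functor.mapGrpNatIso, Functor.mapGrpCompIso]
  exact Category.id_comp _

/-- `baseChangeCompGrpIso⁻¹` commutes with the projections to `A`: `(A_{S'})_T → A_T → A` is `pr ≫ pr`.
[cite: GortzWedhorn2020, Prop. 4.16 and Section (4.7)] -/
@[reassoc]
theorem baseChangeCompGrpIso_inv_left_fst (f' : T ⟶ S') :
    (A.baseChangeCompGrpIso g f').inv.hom.hom.left ≫ pullback.fst A.X.hom (f' ≫ g) =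
      pullback.fst (pullback.snd A.X.hom g) f' ≫ pullback.fst A.X.hom g := by
  rw [baseChangeCompGrpIso_inv_hom_hom]
  exact Motives.pullbackComp_inv_app_left_comp_fst f' g A.X

/-- `baseChangeCompGrpIso⁻¹` commutes with the projections to `T`. [cite: GortzWedhorn2020, Section (4.7) (p. 135)] -/
@[reassoc]
theorem baseChangeCompGrpIso_inv_left_snd (f' : T ⟶ S') :
    (A.baseChangeCompGrpIso g f').inv.hom.hom.left ≫ pullback.snd A.X.hom (f' ≫ g) =
      pullback.snd (pullback.snd A.X.hom g) f' :=
  Over.w ((A.baseChangeCompGrpIso g f').inv.hom.hom)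

/-- `baseChangeCompGrpIso` commutes with the projections to `T`. [cite: GortzWedhorn2020, Section (4.7) (p. 135)] -/
@[reassoc]
theorem baseChangeCompGrpIso_hom_left_snd (f' : T ⟶ S') :
    (A.baseChangeCompGrpIso g f').hom.hom.hom.left ≫ pullback.snd (pullback.snd A.X.hom g) f' =
      pullback.snd A.X.hom (f' ≫ g) :=
  Over.w ((A.baseChangeCompGrpIso g f').hom.hom.hom)

/-- `hom ≫ inv = 𝟙` on underlying schemes. [cite: GortzWedhorn2020, Section (4.7) (p. 135)] -/
@[reassoc]
theorem baseChangeCompGrpIso_hom_left_inv_left (f' : T ⟶ S') :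
    (A.baseChangeCompGrpIso g f').hom.hom.hom.left ≫ (A.baseChangeCompGrpIso g f').inv.hom.hom.left = 𝟙 _ := by
  rw [← Over.comp_left]
  change ((A.baseChangeCompGrpIso g f').hom ≫ (A.baseChangeCompGrpIso g f').inv).hom.hom.left = _
  rw [Iso.hom_inv_id]
  rfl

/-- `inv ≫ hom = 𝟙` on underlying schemes. [cite: GortzWedhorn2020, Section (4.7) (p. 135)] -/
@[reassoc]
theorem baseChangeCompGrpIso_inv_left_hom_left (f' : T ⟶ S') :
    (A.baseChangeCompGrpIso g f').inv.hom.hom.left ≫ (A.baseChangeCompGrpIso g f').hom.hom.hom.left = 𝟙 _ := by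
  rw [← Over.comp_left]
  change ((A.baseChangeCompGrpIso g f').inv ≫ (A.baseChangeCompGrpIso g f').hom).hom.hom.left = _
  rw [Iso.inv_hom_id]
  rfl

/-- `baseChangeCompGrpIso` commutes with the projections to `A`. [cite: GortzWedhorn2020, Prop. 4.16 and Section (4.7)] -/
@[reassoc]
theorem baseChangeCompGrpIso_hom_left_fst_fst (f' : T ⟶ S') :
    (A.baseChangeCompGrpIso g f').hom.hom.hom.left ≫ pullback.fst (pullback.snd A.X.hom g) f' ≫
        pullback.fst A.X.hom g = pullback.fst A.X.hom (f' ≫ g) := by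
  rw [baseChangeCompGrpIso_hom_hom_hom]
  exact Motives.pullbackComp_hom_app_left_comp_fst_fst f' g A.X

/-- **The identity sections correspond** under `baseChangeCompGrpIso` (it is an isomorphism of group schemes).
[cite: GortzWedhorn2020, Remark 16.54 (p. 678)] -/
@[reassoc]
theorem unitSection_comp_baseChangeCompGrpIso_hom_left (f' : T ⟶ S') :
    (A.baseChange (f' ≫ g)).unitSection ≫ (A.baseChangeCompGrpIso g f').hom.hom.hom.left =
      ((A.baseChange g).baseChange f').unitSection := by
  change (η[(A.baseChange (f' ≫ g)).X]).left ≫ _ = (η[((A.baseChange g).baseChange f').X]).left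
  rw [← Over.comp_left, IsMonHom.one_hom]

/-- The base-changed identity section: `ε_{A_{S'}} ≫ pr_A = g ≫ ε_A` (the identity section of the transported
group structure is the pull-back of the identity section). [cite: GortzWedhorn2020, Remark 16.54 (p. 678)] -/
@[reassoc]
theorem unitSection_baseChange_comp_fst :
    (A.baseChange g).unitSection ≫ pullback.fst A.X.hom g = g ≫ A.unitSection := by
  -- the identity section of the transported group structure is `ε ≫ (Over.pullback g).map η`
  change (Functor.LaxMonoidal.ε (Over.pullback g) ≫ (Over.pullback g).map η[A.X]).left ≫ pullback.fst A.X.hom g = _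
  -- the two projections of `(Over.pullback g).map η = η ×_S S'`
  have hc : ((Over.pullback g).map η[A.X]).left ≫ pullback.fst A.X.hom g =
      pullback.fst (𝟙_ (Over S)).hom g ≫ (η[A.X]).left := by
    simp only [Over.pullback_map_left]
    erw [pullback.lift_fst]
  -- over `S`, the first projection `S ×_S S' → S` is the second one followed by `g`
  have h1 : pullback.fst (𝟙_ (Over S)).hom g = pullback.snd (𝟙_ (Over S)).hom g ≫ g :=
    (Category.comp_id _).symm.trans pullback.condition
  have h1' : pullback.fst (𝟙_ (Over S)).hom g ≫ (η[A.X]).left =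
      pullback.snd (𝟙_ (Over S)).hom g ≫ g ≫ A.unitSection := by
    rw [h1]; exact Category.assoc _ _ _
  -- `ε.left ≫ pr₂ = 𝟙 S'`
  have hε : (Functor.LaxMonoidal.ε (Over.pullback g)).left ≫ pullback.snd (𝟙_ (Over S)).hom g = 𝟙 _ :=
    Over.w (Functor.LaxMonoidal.ε (Over.pullback g))
  rw [Over.comp_left, Category.assoc, hc, h1']
  calc (Functor.LaxMonoidal.ε (Over.pullback g)).left ≫ pullback.snd (𝟙_ (Over S)).hom g ≫ g ≫ A.unitSection
      = ((Functor.LaxMonoidal.ε (Over.pullback g)).left ≫ pullback.snd (𝟙_ (Over S)).hom g) ≫ g ≫ A.unitSection :=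
        (Category.assoc _ _ _).symm
    _ = g ≫ A.unitSection := by rw [hε]; exact Category.id_comp _

section Fibre

variable {Ω : Type u} [Field Ω] (t : Spec (.of Ω) ⟶ S')

/-- **The fibre of `A_{S'}` at `t` is the fibre of `A` at `t ≫ g`**, as abelian varieties over `Ω` (the fibre form of
`baseChangeCompGrpIso`, through `InducedCategory.isoMk`; cf. ★ `AbelianScheme.fibreBaseChangeIso` for the affine
carrier). [cite: GortzWedhorn2020, Section (4.7) (p. 135)] -/
def fibreBaseChangeIso : ((A.baseChange g).fibre t).toAbelianVariety ≅ (A.fibre (t ≫ g)).toAbelianVariety :=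
  (InducedCategory.isoMk (X := (A.fibre (t ≫ g)).toAbelianVariety)
    (Y := ((A.baseChange g).fibre t).toAbelianVariety) (A.baseChangeCompGrpIso g t)).symm

/-- The underlying scheme morphism of `fibreBaseChangeIso` is that of `baseChangeCompGrpIso⁻¹` (definitional).
[cite: GortzWedhorn2020, Section (4.7) (p. 135)] -/
theorem fibreBaseChangeIso_hom_toSchemeHom :
    AbelianVariety.Hom.toSchemeHom (A.fibreBaseChangeIso g t).hom = (A.baseChangeCompGrpIso g t).inv.hom.hom.left :=
  rfl

/-- `fibreBaseChangeIso` commutes with the projections to `A`. [cite: GortzWedhorn2020, Section (4.7) (p. 135)] -/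
@[reassoc]
theorem fibreBaseChangeIso_hom_toSchemeHom_fst :
    AbelianVariety.Hom.toSchemeHom (A.fibreBaseChangeIso g t).hom ≫ pullback.fst A.X.hom (t ≫ g) =
      pullback.fst (pullback.snd A.X.hom g) t ≫ pullback.fst A.X.hom g :=
  A.baseChangeCompGrpIso_inv_left_fst g t

/-- `fibreBaseChangeIso` commutes with the projections to `Spec Ω`. [cite: GortzWedhorn2020, Section (4.7) (p. 135)] -/
@[reassoc]
theorem fibreBaseChangeIso_hom_toSchemeHom_snd :
    AbelianVariety.Hom.toSchemeHom (A.fibreBaseChangeIso g t).hom ≫ pullback.snd A.X.hom (t ≫ g) =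
      pullback.snd (pullback.snd A.X.hom g) t :=
  A.baseChangeCompGrpIso_inv_left_snd g t

end Fibre

/-! ### §0b Transport along `A_{f' ≫ g} ≅ (A_{S'})_{f'}`: modules, fibres, rigidified line bundles -/

section AlongBaseChange

variable {T : Scheme.{u}} (f' : T ⟶ S')

/-- The underlying `T`-morphism `A_{f' ≫ g} ⟶ (A_{S'})_{f'}` of `baseChangeCompGrpIso` (non-Prop plumbing).
[cite: GortzWedhorn2020, Section (4.7) (p. 135)] -/
abbrev bcHomLeft : (A.baseChange (f' ≫ g)).X.left ⟶ ((A.baseChange g).baseChange f').X.left :=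
  (A.baseChangeCompGrpIso g f').hom.hom.hom.left

/-- The underlying `T`-morphism `(A_{S'})_{f'} ⟶ A_{f' ≫ g}` of `baseChangeCompGrpIso⁻¹` (non-Prop plumbing).
[cite: GortzWedhorn2020, Section (4.7) (p. 135)] -/
abbrev bcInvLeft : ((A.baseChange g).baseChange f').X.left ⟶ (A.baseChange (f' ≫ g)).X.left :=
  (A.baseChangeCompGrpIso g f').inv.hom.hom.left

/-- `e^* (e⁻¹)^* M ≅ M` (pull-back along `e` and `e⁻¹`). [cite: GortzWedhorn2020, Section (4.7) (p. 135)] -/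
def pullbackHomPullbackInvIso (M : (A.baseChange (f' ≫ g)).X.left.Modules) :
    (Scheme.Modules.pullback (A.bcHomLeft g f')).obj ((Scheme.Modules.pullback (A.bcInvLeft g f')).obj M) ≅ M :=
  (Scheme.Modules.pullbackComp _ _).app M ≪≫
    (Scheme.Modules.pullbackCongr (A.baseChangeCompGrpIso_hom_left_inv_left g f')).app M ≪≫
    (Scheme.Modules.pullbackId _).app M

/-- `(e⁻¹)^* e^* M ≅ M` (pull-back along `e⁻¹` and `e`). [cite: GortzWedhorn2020, Section (4.7) (p. 135)] -/
def pullbackInvPullbackHomIso (M : ((A.baseChange g).baseChange f').X.left.Modules) :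
    (Scheme.Modules.pullback (A.bcInvLeft g f')).obj ((Scheme.Modules.pullback (A.bcHomLeft g f')).obj M) ≅ M :=
  (Scheme.Modules.pullbackComp _ _).app M ≪≫
    (Scheme.Modules.pullbackCongr (A.baseChangeCompGrpIso_inv_left_hom_left g f')).app M ≪≫
    (Scheme.Modules.pullbackId _).app M

/-- The fibres of `A_{f' ≫ g}` and of `(A_{S'})_{f'}` at a point `u` of `T`, as abelian varieties: base change of
the group-scheme isomorphism `baseChangeCompGrpIso` along `u` (Mathlib `Functor.mapGrp.mapIso`).
[cite: GortzWedhorn2020, Section (4.7) (p. 135)] -/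
def fibreAlongBaseChangeIso {Ω : Type u} [Field Ω] (u : Spec (.of Ω) ⟶ T) :
    ((A.baseChange (f' ≫ g)).fibre u).toAbelianVariety ≅ (((A.baseChange g).baseChange f').fibre u).toAbelianVariety :=
  InducedCategory.isoMk (X := ((A.baseChange (f' ≫ g)).fibre u).toAbelianVariety)
    (Y := (((A.baseChange g).baseChange f').fibre u).toAbelianVariety)
    ((Over.pullback u).mapGrp.mapIso (A.baseChangeCompGrpIso g f'))

/-- The underlying scheme morphism of `fibreAlongBaseChangeIso` commutes with the projections to the total spaces:
it is `e ×_T Spec Ω`. [cite: GortzWedhorn2020, Section (4.7) (p. 135)] -/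
@[reassoc]
theorem fibreAlongBaseChangeIso_hom_toSchemeHom_fst {Ω : Type u} [Field Ω] (u : Spec (.of Ω) ⟶ T) :
    AbelianVariety.Hom.toSchemeHom (A.fibreAlongBaseChangeIso g f' u).hom ≫
        pullback.fst ((A.baseChange g).baseChange f').X.hom u =
      pullback.fst (A.baseChange (f' ≫ g)).X.hom u ≫ A.bcHomLeft g f' := by
  change ((Over.pullback u).map (A.baseChangeCompGrpIso g f').hom.hom.hom).left ≫ _ = _
  simp only [Over.pullback_map_left]
  erw [pullback.lift_fst]

end AlongBaseChange

end AbelianSchemeOver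

end Literature.AlgebraicGeometry.AbelianSchemes

end
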